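import Mathlib
import Literature.Analysis.FluidPDE.GaussianVortexPlanar
import Literature.Analysis.FluidPDE.GaussianVortexPlanarProofs
import HarnessLib

/-!
# Helper `hardyWirtinger_even` toward stub `stub_coreInverse` of the line `braid-closed-large-circulation-gluing`
# (crux stmt-AnomalousDissipation-3009, `MarginalStabilityChain.StretchedVortexRows`)

The **Hardy–Wirtinger inequality** `∫ φ²/|ξ|² ≤ ¼ ∫ |∇φ|²` on `ℝ² = EuclideanSpace ℝ (Fin 2)` for `C¹` functions
`φ` that are EVEN (`φ(−ξ) = φ(ξ)`) and have ZERO CIRCULAR MEANS (`∫₀^{2π} φ(r cos θ, r sin θ) dθ = 0` for every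
`r > 0`), i.e. carry no angular Fourier modes `m ∈ {0, ±1}`; it converts the rotation energy into coercivity in the
energy method for `stub_coreInverse` (ingredient (I7) of the lead's plan). Proof, circle by circle:

* `wirtinger_periodic`: the SHARP periodic Wirtinger inequality `∫ₐᵇ g² ≤ ((b−a)/2π)² ∫ₐᵇ g'²` for `g ∈ C¹(ℝ)` with
  `g a = g b` and `∫ₐᵇ g = 0`, by Parseval on `(a, b]` (Mathlib `hasSum_sq_fourierCoeffOn`) and the integration by
  parts formula `ĝ(n) = (b−a)/(2πin) · ĝ'(n)` (`fourierCoeffOn_of_hasDerivAt`, no boundary term since `g a = g b`),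
  `ĝ(0) = 0` by the zero mean, and the termwise bound `|ĝ(n)|² ≤ ((b−a)/2π)² |ĝ'(n)|²`.
* `integral_sq_circle_le`: on the circle of radius `r`, `g(θ) = φ(r cos θ, r sin θ)` is `π`-PERIODIC by evenness, has
  zero mean on `[0, π]` and `[−π, 0]` (half of the vanishing `2π`-mean), so Wirtinger with `b − a = π` on both half
  periods gives `∫_{−π}^{π} g² ≤ ¼ ∫_{−π}^{π} g'²`, and `g'(θ) = ⟪∇φ(ξ), ξ^⊥⟫`, `|g'| ≤ r |∇φ(ξ)|` (chain rule and
  Cauchy–Schwarz): `∫_{−π}^{π} φ(γ_r)² ≤ (r²/4) ∫_{−π}^{π} |∇φ(γ_r)|²`.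
* `lintegral_eq_lintegral_polar`: polar coordinates for lower Lebesgue integrals on `EuclideanSpace ℝ (Fin 2)`
  (Mathlib `lintegral_comp_polarCoord_symm` transported along the volume-preserving `ℝ² ≃ ℝ × ℝ`, then Tonelli).
* assembly: `∫⁻ φ²/|ξ|² = ∫₀^∞ (∫ g_r² dθ) r⁻¹ dr ≤ ∫₀^∞ (r/4) ∫ |∇φ(γ_r)|² dθ dr = ∫⁻ |∇φ|²/4 < ∞`, which gives
  both the integrability of `φ²/|ξ|²` and the inequality (lower integrals first, so no circularity).

References: G. H. Hardy, J. E. Littlewood, G. Pólya, *Inequalities*, Thm. 258 (Wirtinger); Th. Gallay, C. E. Wayne,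
Comm. Math. Phys. 255 (2005) §4; Th. Gallay, Y. Maekawa, arXiv:1610.08384 §4.1.
-/

set_option linter.dupNamespace false

noncomputable section

open scoped RealInnerProductSpace Topology Laplacian ENNReal
open MeasureTheory WithLp Function Set Real intervalIntegral

namespace Summit.AnomalousDissipation.AnomalousDissipation.Theorems.MarginalStabilityChainStretchedVortexRows

open Literature.Analysis.FluidPDE

/-! ### The sharp periodic Wirtinger inequality -/

/-- **Wirtinger's inequality (sharp periodic form).** For `g ∈ C¹(ℝ)` with `g a = g b` and `∫ₐᵇ g = 0`:
`∫ₐᵇ g² ≤ ((b − a)/(2π))² ∫ₐᵇ g'²` — Parseval on `(a, b]` plus `ĝ(n) = (b−a)/(2πin)·ĝ'(n)` (`n ≠ 0`), `ĝ(0) = 0`. [folklore] -/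
theorem wirtinger_periodic {g : ℝ → ℝ} (hg : ContDiff ℝ 1 g) {a b : ℝ} (hab : a < b)
    (hper : g a = g b) (hmean : ∫ x in a..b, g x = 0) :
    ∫ x in a..b, g x ^ 2 ≤ ((b - a) / (2 * π)) ^ 2 * ∫ x in a..b, deriv g x ^ 2 := by
  have hd : Differentiable ℝ g := hg.differentiable (by simp)
  have hgc : Continuous g := hg.continuous
  have hdc : Continuous (deriv g) := hg.continuous_deriv (by simp)
  have hL : 0 < b - a := sub_pos.2 hab
  -- complexification
  set G : ℝ → ℂ := fun x => (g x : ℂ) with hGdef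
  set G' : ℝ → ℂ := fun x => ((deriv g x : ℝ) : ℂ) with hG'def
  have hGd : ∀ x, HasDerivAt G (G' x) x := fun x => (hd x).hasDerivAt.ofReal_comp
  have hGc : Continuous G := Complex.continuous_ofReal.comp hgc
  have hG'c : Continuous G' := Complex.continuous_ofReal.comp hdc
  -- termwise comparison of the Fourier coefficients
  have hcoef : ∀ n : ℤ, ‖fourierCoeffOn hab G n‖ ^ 2 ≤
      ((b - a) / (2 * π)) ^ 2 * ‖fourierCoeffOn hab G' n‖ ^ 2 := by
    intro n
    rcases eq_or_ne n 0 with rfl | hn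
    · have h0 : fourierCoeffOn hab G 0 = 0 := by
        rw [fourierCoeffOn_eq_integral]
        simp [G, intervalIntegral.integral_ofReal, hmean]
      rw [h0, norm_zero, zero_pow two_ne_zero]
      positivity
    · have h := fourierCoeffOn_of_hasDerivAt hab hn (fun x _ => hGd x) (hG'c.intervalIntegrable _ _)
      have hGab : G b - G a = 0 := by simp [G, hper]
      rw [hGab, mul_zero, zero_sub] at h
      have hn1 : (1 : ℝ) ≤ |(n : ℝ)| := by
        rw [← Int.cast_abs]; exact_mod_cast Int.one_le_abs hn
      have hba : ‖((b : ℂ) - a)‖ = b - a := by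
        rw [← Complex.ofReal_sub, Complex.norm_real, Real.norm_eq_abs, abs_of_pos hL]
      have key : ‖fourierCoeffOn hab G n‖ =
          (b - a) / (2 * π * |(n : ℝ)|) * ‖fourierCoeffOn hab G' n‖ := by
        rw [h, norm_mul, norm_neg, norm_mul, hba]
        simp [Complex.norm_real, abs_of_pos Real.pi_pos]
        ring
      have hle : ‖fourierCoeffOn hab G n‖ ≤ (b - a) / (2 * π) * ‖fourierCoeffOn hab G' n‖ := by
        rw [key]
        refine mul_le_mul_of_nonneg_right ?_ (norm_nonneg _)
        refine div_le_div_of_nonneg_left hL.le (by positivity) ?_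
        nlinarith [Real.pi_pos]
      calc ‖fourierCoeffOn hab G n‖ ^ 2 ≤ ((b - a) / (2 * π) * ‖fourierCoeffOn hab G' n‖) ^ 2 :=
            pow_le_pow_left₀ (norm_nonneg _) hle 2
        _ = _ := by ring
  -- Parseval on `(a, b]` for `G` and `G'`
  have hL2 : ∀ {F : ℝ → ℂ}, Continuous F → MemLp F 2 (volume.restrict (Ioc a b)) := by
    intro F hF
    refine (memLp_two_iff_integrable_sq_norm hF.aestronglyMeasurable).2 ?_
    exact (hF.norm.pow 2).integrableOn_Ioc
  have hS := hasSum_sq_fourierCoeffOn hab (hL2 hGc)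
  have hS' := (hasSum_sq_fourierCoeffOn hab (hL2 hG'c)).mul_left (((b - a) / (2 * π)) ^ 2)
  have hcmp := hasSum_le hcoef hS hS'
  have e1 : ∫ x in a..b, ‖G x‖ ^ 2 = ∫ x in a..b, g x ^ 2 := by
    refine intervalIntegral.integral_congr fun x _ => ?_
    simp [G]
  have e2 : ∫ x in a..b, ‖G' x‖ ^ 2 = ∫ x in a..b, deriv g x ^ 2 := by
    refine intervalIntegral.integral_congr fun x _ => ?_
    simp [G']
  rw [e1] at hcmp
  rw [e2] at hcmp
  simp only [smul_eq_mul] at hcmp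
  have := mul_le_mul_of_nonneg_left hcmp hL.le
  have e3 : (b - a) * ((b - a)⁻¹ * ∫ x in a..b, g x ^ 2) = ∫ x in a..b, g x ^ 2 := by
    field_simp
  have e4 : (b - a) * (((b - a) / (2 * π)) ^ 2 * ((b - a)⁻¹ * ∫ x in a..b, deriv g x ^ 2)) =
      ((b - a) / (2 * π)) ^ 2 * ∫ x in a..b, deriv g x ^ 2 := by
    field_simp
  linarith [e3, e4]

/-! ### The circle-wise bound -/

/-- **Circle-wise Hardy–Wirtinger.** For `φ ∈ C¹(ℝ²)` even with zero circular means and `r > 0`: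
`∫_{−π}^{π} φ(γ_r(θ))² dθ ≤ (r²/4) ∫_{−π}^{π} |∇φ(γ_r(θ))|² dθ`, `γ_r(θ) = (r cos θ, r sin θ)` — `φ ∘ γ_r` is `π`-periodic
(evenness) with zero mean on each half period, so the sharp Wirtinger inequality with period `π` applies, and
`|(φ ∘ γ_r)'| = |⟪∇φ, γ_r'⟫| ≤ r |∇φ|`. [folklore] -/
theorem integral_sq_circle_le (φ : EuclideanSpace ℝ (Fin 2) → ℝ) (hφ : ContDiff ℝ 1 φ)
    (heven : ∀ ξ, φ (-ξ) = φ ξ)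
    (hmean : ∀ r, 0 < r → ∫ θ in (0:ℝ)..(2 * Real.pi), φ (toLp 2 ![r * Real.cos θ, r * Real.sin θ]) = 0)
    {r : ℝ} (hr : 0 < r) :
    ∫ θ in (-π)..π, φ (toLp 2 ![r * Real.cos θ, r * Real.sin θ]) ^ 2 ≤
      r ^ 2 / 4 * ∫ θ in (-π)..π, ‖gradient φ (toLp 2 ![r * Real.cos θ, r * Real.sin θ])‖ ^ 2 := by
  -- the circle of radius `r` and its velocity
  set a : EuclideanSpace ℝ (Fin 2) := toLp 2 ![r, 0] with ha
  set b : EuclideanSpace ℝ (Fin 2) := toLp 2 ![0, r] with hb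
  set γ : ℝ → EuclideanSpace ℝ (Fin 2) := fun θ => toLp 2 ![r * Real.cos θ, r * Real.sin θ] with hγ
  set γ' : ℝ → EuclideanSpace ℝ (Fin 2) := fun θ => (-Real.sin θ) • a + Real.cos θ • b with hγ'
  have hγab : γ = fun θ => Real.cos θ • a + Real.sin θ • b := by
    funext θ
    ext i
    fin_cases i <;> simp [hγ, ha, hb, mul_comm]
  have hγd : ∀ θ, HasDerivAt γ (γ' θ) θ := by
    intro θ
    rw [hγab]
    exact ((Real.hasDerivAt_cos θ).smul_const a).add ((Real.hasDerivAt_sin θ).smul_const b)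
  have hγ'n : ∀ θ, ‖γ' θ‖ = r := by
    intro θ
    have h2 : ‖γ' θ‖ ^ 2 = r ^ 2 := by
      rw [EuclideanSpace.real_norm_sq_eq, Fin.sum_univ_two]
      simp [hγ', ha, hb]
      nlinarith [Real.sin_sq_add_cos_sq θ]
    nlinarith [norm_nonneg (γ' θ), sq_nonneg (‖γ' θ‖ - r), sq_nonneg (‖γ' θ‖ + r)]
  have hγπ : ∀ θ, γ (θ + π) = -γ θ := by
    intro θ
    ext i
    fin_cases i <;> simp [hγ, Real.cos_add_pi, Real.sin_add_pi]
  -- the restriction `g = φ ∘ γ`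
  set g : ℝ → ℝ := fun θ => φ (γ θ) with hg
  have hγC : ContDiff ℝ 1 γ := by
    rw [hγab]; fun_prop
  have hgC : ContDiff ℝ 1 g := hφ.comp hγC
  have hgd : ∀ θ, HasDerivAt g (fderiv ℝ φ (γ θ) (γ' θ)) θ := fun θ =>
    ((hφ.differentiable (by simp)) (γ θ)).hasFDerivAt.comp_hasDerivAt θ (hγd θ)
  have hinner : ∀ θ, deriv g θ = ⟪gradient φ (γ θ), γ' θ⟫ := fun θ => by
    rw [(hgd θ).deriv, gradient, InnerProductSpace.toDual_symm_apply]
  have hper : Function.Periodic g π := fun θ => by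
    show φ (γ (θ + π)) = φ (γ θ)
    rw [hγπ, heven]
  have hgc : Continuous g := hgC.continuous
  have hdc : Continuous (deriv g) := hgC.continuous_deriv (by simp)
  have hii : ∀ s t, IntervalIntegrable g volume s t := fun s t => hgc.intervalIntegrable _ _
  -- zero means on the half periods `[0, π]` and `[-π, 0]`
  have h2π : ∫ θ in (0:ℝ)..(2 * π), g θ = 0 := hmean r hr
  have hsplit : ∫ θ in (0:ℝ)..(2 * π), g θ = (∫ θ in (0:ℝ)..π, g θ) + ∫ θ in π..(2 * π), g θ :=
    (integral_add_adjacent_intervals (hii _ _) (hii _ _)).symm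
  have hshift1 : ∫ θ in π..(2 * π), g θ = ∫ θ in (0:ℝ)..π, g θ := by
    have := hper.intervalIntegral_add_eq π 0
    rw [zero_add, ← two_mul] at this
    exact this
  have hmean0 : ∫ θ in (0:ℝ)..π, g θ = 0 := by linarith
  have hmean1 : ∫ θ in (-π)..0, g θ = 0 := by
    have := hper.intervalIntegral_add_eq (-π) 0
    rw [neg_add_cancel, zero_add] at this
    rw [this, hmean0]
  -- the sharp Wirtinger inequality on both half periods
  have hW0 := wirtinger_periodic hgC pi_pos (by simpa using (hper 0).symm) hmean0
  have hW1 := wirtinger_periodic hgC (neg_lt_zero.2 pi_pos) (by simpa using (hper (-π)).symm) hmean1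
  have e0 : ((π - 0) / (2 * π)) ^ 2 = 1 / 4 := by field_simp; norm_num
  have e1 : ((0 - -π) / (2 * π)) ^ 2 = 1 / 4 := by field_simp; norm_num
  rw [e0] at hW0
  rw [e1] at hW1
  have hii2 : ∀ s t, IntervalIntegrable (fun θ => g θ ^ 2) volume s t := fun s t =>
    (hgc.pow 2).intervalIntegrable _ _
  have hii3 : ∀ s t, IntervalIntegrable (fun θ => deriv g θ ^ 2) volume s t := fun s t =>
    (hdc.pow 2).intervalIntegrable _ _
  have hsum2 : ∫ θ in (-π)..π, g θ ^ 2 = (∫ θ in (-π)..0, g θ ^ 2) + ∫ θ in (0:ℝ)..π, g θ ^ 2 :=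
    (integral_add_adjacent_intervals (hii2 _ _) (hii2 _ _)).symm
  have hsum3 : ∫ θ in (-π)..π, deriv g θ ^ 2 =
      (∫ θ in (-π)..0, deriv g θ ^ 2) + ∫ θ in (0:ℝ)..π, deriv g θ ^ 2 :=
    (integral_add_adjacent_intervals (hii3 _ _) (hii3 _ _)).symm
  -- `g'² ≤ r² |∇φ ∘ γ|²`
  have hgrad : Continuous (gradient φ) :=
    (InnerProductSpace.toDual ℝ (EuclideanSpace ℝ (Fin 2))).symm.continuous.comp
      (hφ.continuous_fderiv (by simp))
  have hpt : ∀ θ, deriv g θ ^ 2 ≤ r ^ 2 * ‖gradient φ (γ θ)‖ ^ 2 := by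
    intro θ
    rw [hinner, ← sq_abs]
    have h := abs_real_inner_le_norm (gradient φ (γ θ)) (γ' θ)
    rw [hγ'n] at h
    calc |⟪gradient φ (γ θ), γ' θ⟫| ^ 2 ≤ (‖gradient φ (γ θ)‖ * r) ^ 2 :=
          pow_le_pow_left₀ (abs_nonneg _) h 2
      _ = r ^ 2 * ‖gradient φ (γ θ)‖ ^ 2 := by ring
  have hmono : ∫ θ in (-π)..π, deriv g θ ^ 2 ≤ ∫ θ in (-π)..π, r ^ 2 * ‖gradient φ (γ θ)‖ ^ 2 :=
    intervalIntegral.integral_mono_on (by linarith [pi_pos]) (hii3 _ _)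
      ((((hgrad.comp hγC.continuous).norm.pow 2).const_mul _).intervalIntegrable _ _) fun θ _ => hpt θ
  rw [intervalIntegral.integral_const_mul] at hmono
  show ∫ θ in (-π)..π, g θ ^ 2 ≤ r ^ 2 / 4 * ∫ θ in (-π)..π, ‖gradient φ (γ θ)‖ ^ 2
  rw [hsum2]
  have : (∫ θ in (-π)..0, deriv g θ ^ 2) + ∫ θ in (0:ℝ)..π, deriv g θ ^ 2 ≤
      r ^ 2 * ∫ θ in (-π)..π, ‖gradient φ (γ θ)‖ ^ 2 := hsum3 ▸ hmono
  nlinarith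

/-! ### Polar coordinates for lower integrals on `EuclideanSpace ℝ (Fin 2)` -/

/-- **Polar coordinates on `ℝ²`, lower-integral form**: `∫⁻ f = ∫⁻_{r>0} ∫⁻_{θ∈(−π,π)} r · f(r cos θ, r sin θ)` for measurable
`f : EuclideanSpace ℝ (Fin 2) → ℝ≥0∞` (Mathlib's `lintegral_comp_polarCoord_symm` on `ℝ × ℝ`, transported along the
volume-preserving identification `ℝ² ≃ ℝ × ℝ`, then Tonelli). [folklore] -/
theorem lintegral_eq_lintegral_polar (f : EuclideanSpace ℝ (Fin 2) → ℝ≥0∞) (hf : Measurable f) :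
    ∫⁻ ξ, f ξ = ∫⁻ r in Ioi (0:ℝ), ∫⁻ θ in Ioo (-π) π,
      ENNReal.ofReal r * f (toLp 2 ![r * Real.cos θ, r * Real.sin θ]) := by
  set T : EuclideanSpace ℝ (Fin 2) ≃ᵐ ℝ × ℝ :=
    (MeasurableEquiv.toLp 2 (Fin 2 → ℝ)).symm.trans MeasurableEquiv.finTwoArrow with hT
  have hTmp : MeasurePreserving T volume volume :=
    (EuclideanSpace.volume_preserving_symm_measurableEquiv_toLp (Fin 2)).trans
      (volume_preserving_finTwoArrow ℝ)
  have hF : Measurable fun p : ℝ × ℝ =>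
      ENNReal.ofReal p.1 * f (toLp 2 ![p.1 * Real.cos p.2, p.1 * Real.sin p.2]) := by
    have h1 : (fun p : ℝ × ℝ => (toLp 2 ![p.1 * Real.cos p.2, p.1 * Real.sin p.2] :
        EuclideanSpace ℝ (Fin 2))) = T.symm ∘ polarCoord.symm := by
      funext p
      rfl
    have h2 : Measurable fun p : ℝ × ℝ => (toLp 2 ![p.1 * Real.cos p.2, p.1 * Real.sin p.2] :
        EuclideanSpace ℝ (Fin 2)) := by
      rw [h1]; exact T.symm.measurable.comp continuous_polarCoord_symm.measurable
    exact measurable_fst.ennreal_ofReal.mul (hf.comp h2)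
  calc ∫⁻ ξ, f ξ = ∫⁻ q : ℝ × ℝ, f (T.symm q) :=
        (hTmp.symm.lintegral_comp_emb T.symm.measurableEmbedding f).symm
    _ = ∫⁻ p in polarCoord.target, ENNReal.ofReal p.1 • f (T.symm (polarCoord.symm p)) :=
        (lintegral_comp_polarCoord_symm (fun q => f (T.symm q))).symm
    _ = ∫⁻ p in Ioi (0:ℝ) ×ˢ Ioo (-π) π,
          ENNReal.ofReal p.1 * f (toLp 2 ![p.1 * Real.cos p.2, p.1 * Real.sin p.2]) := by
        rfl
    _ = ∫⁻ r in Ioi (0:ℝ), ∫⁻ θ in Ioo (-π) π,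
          ENNReal.ofReal r * f (toLp 2 ![r * Real.cos θ, r * Real.sin θ]) := by
        rw [Measure.volume_eq_prod, ← Measure.prod_restrict, lintegral_prod _ hF.aemeasurable]

/-! ### The Hardy–Wirtinger inequality -/

/-- H5 (I7): Hardy–Wirtinger for EVEN functions with zero circular means: `∫ φ²/|ξ|² ≤ ¼ ∫ |∇φ|²`. -/
theorem hardyWirtinger_even :
    ∀ φ : EuclideanSpace ℝ (Fin 2) → ℝ, ContDiff ℝ 1 φ → (∀ ξ, φ (-ξ) = φ ξ) →
      (∀ r, 0 < r → ∫ θ in (0:ℝ)..(2 * Real.pi), φ (toLp 2 ![r * Real.cos θ, r * Real.sin θ]) = 0) →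
      Integrable (fun ξ => ‖gradient φ ξ‖ ^ 2) →
      Integrable (fun ξ => φ ξ ^ 2 / ‖ξ‖ ^ 2) ∧
        ∫ ξ, φ ξ ^ 2 / ‖ξ‖ ^ 2 ≤ 1 / 4 * ∫ ξ, ‖gradient φ ξ‖ ^ 2 := by
  intro φ hφ heven hmean hint
  have hφc : Continuous φ := hφ.continuous
  have hgrad : Continuous (gradient φ) :=
    (InnerProductSpace.toDual ℝ (EuclideanSpace ℝ (Fin 2))).symm.continuous.comp
      (hφ.continuous_fderiv (by simp))
  -- the circle map is continuous in `θ` and has norm `r`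
  have hγc : ∀ r : ℝ, Continuous fun θ : ℝ =>
      (toLp 2 ![r * Real.cos θ, r * Real.sin θ] : EuclideanSpace ℝ (Fin 2)) := fun r =>
    (PiLp.continuous_toLp 2 _).comp (continuous_pi fun i => by fin_cases i <;> simp <;> fun_prop)
  have hnorm : ∀ r θ : ℝ, 0 < r →
      ‖(toLp 2 ![r * Real.cos θ, r * Real.sin θ] : EuclideanSpace ℝ (Fin 2))‖ = r := by
    intro r θ hr
    have h2 : ‖(toLp 2 ![r * Real.cos θ, r * Real.sin θ] : EuclideanSpace ℝ (Fin 2))‖ ^ 2 = r ^ 2 := by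
      rw [EuclideanSpace.real_norm_sq_eq, Fin.sum_univ_two]
      simp
      nlinarith [Real.sin_sq_add_cos_sq θ]
    nlinarith [norm_nonneg (toLp 2 ![r * Real.cos θ, r * Real.sin θ] : EuclideanSpace ℝ (Fin 2)),
      sq_nonneg (‖(toLp 2 ![r * Real.cos θ, r * Real.sin θ] : EuclideanSpace ℝ (Fin 2))‖ - r),
      sq_nonneg (‖(toLp 2 ![r * Real.cos θ, r * Real.sin θ] : EuclideanSpace ℝ (Fin 2))‖ + r)]
  -- Step A: the circle-wise inequality, in `lintegral` form (weights `r · (1/r²)` and `r`)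
  have hslice : ∀ r, 0 < r →
      ∫⁻ θ in Ioo (-π) π, ENNReal.ofReal r *
          ENNReal.ofReal (φ (toLp 2 ![r * Real.cos θ, r * Real.sin θ]) ^ 2 /
            ‖(toLp 2 ![r * Real.cos θ, r * Real.sin θ] : EuclideanSpace ℝ (Fin 2))‖ ^ 2)
        ≤ ∫⁻ θ in Ioo (-π) π, ENNReal.ofReal r *
          ENNReal.ofReal (‖gradient φ (toLp 2 ![r * Real.cos θ, r * Real.sin θ])‖ ^ 2 / 4) := by
    intro r hr
    have e1 : ∀ θ, ENNReal.ofReal r *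
        ENNReal.ofReal (φ (toLp 2 ![r * Real.cos θ, r * Real.sin θ]) ^ 2 /
          ‖(toLp 2 ![r * Real.cos θ, r * Real.sin θ] : EuclideanSpace ℝ (Fin 2))‖ ^ 2) =
        ENNReal.ofReal (φ (toLp 2 ![r * Real.cos θ, r * Real.sin θ]) ^ 2 / r) := by
      intro θ
      rw [← ENNReal.ofReal_mul hr.le, hnorm r θ hr]
      congr 1
      field_simp
    have e2 : ∀ θ, ENNReal.ofReal r *
        ENNReal.ofReal (‖gradient φ (toLp 2 ![r * Real.cos θ, r * Real.sin θ])‖ ^ 2 / 4) =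
        ENNReal.ofReal (r * ‖gradient φ (toLp 2 ![r * Real.cos θ, r * Real.sin θ])‖ ^ 2 / 4) := by
      intro θ
      rw [← ENNReal.ofReal_mul hr.le]
      congr 1
      ring
    simp_rw [e1, e2]
    have hc1 : Continuous fun θ => φ (toLp 2 ![r * Real.cos θ, r * Real.sin θ]) ^ 2 / r :=
      ((hφc.comp (hγc r)).pow 2).div_const r
    have hc2 : Continuous fun θ =>
        r * ‖gradient φ (toLp 2 ![r * Real.cos θ, r * Real.sin θ])‖ ^ 2 / 4 :=
      ((((hgrad.comp (hγc r)).norm).pow 2).const_mul r).div_const 4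
    rw [← ofReal_integral_eq_lintegral_ofReal (hc1.integrableOn_Icc.mono_set Ioo_subset_Icc_self)
        (Filter.Eventually.of_forall fun θ => (by positivity :
          (0:ℝ) ≤ φ (toLp 2 ![r * Real.cos θ, r * Real.sin θ]) ^ 2 / r)),
      ← ofReal_integral_eq_lintegral_ofReal (hc2.integrableOn_Icc.mono_set Ioo_subset_Icc_self)
        (Filter.Eventually.of_forall fun θ => (by positivity :
          (0:ℝ) ≤ r * ‖gradient φ (toLp 2 ![r * Real.cos θ, r * Real.sin θ])‖ ^ 2 / 4))]
    refine ENNReal.ofReal_le_ofReal ?_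
    rw [← integral_Ioc_eq_integral_Ioo, ← intervalIntegral.integral_of_le (by linarith [pi_pos]),
      ← integral_Ioc_eq_integral_Ioo, ← intervalIntegral.integral_of_le (by linarith [pi_pos])]
    have hA := integral_sq_circle_le φ hφ heven hmean hr
    calc ∫ θ in (-π)..π, φ (toLp 2 ![r * Real.cos θ, r * Real.sin θ]) ^ 2 / r
        = (∫ θ in (-π)..π, φ (toLp 2 ![r * Real.cos θ, r * Real.sin θ]) ^ 2) / r :=
          intervalIntegral.integral_div _ _
      _ ≤ (r ^ 2 / 4 * ∫ θ in (-π)..π, ‖gradient φ (toLp 2 ![r * Real.cos θ, r * Real.sin θ])‖ ^ 2) / r :=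
          div_le_div_of_nonneg_right hA hr.le
      _ = ∫ θ in (-π)..π, r * ‖gradient φ (toLp 2 ![r * Real.cos θ, r * Real.sin θ])‖ ^ 2 / 4 := by
          rw [intervalIntegral.integral_div, intervalIntegral.integral_const_mul]
          field_simp
  -- Step B: polar coordinates on both sides, and Tonelli
  have hFm : Measurable fun ξ : EuclideanSpace ℝ (Fin 2) => φ ξ ^ 2 / ‖ξ‖ ^ 2 :=
    (hφc.measurable.pow_const 2).div (measurable_norm.pow_const 2)
  have hint4 : Integrable (fun ξ => ‖gradient φ ξ‖ ^ 2 / 4) := hint.div_const 4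
  have hle : ∫⁻ ξ, ENNReal.ofReal (φ ξ ^ 2 / ‖ξ‖ ^ 2) ≤
      ∫⁻ ξ, ENNReal.ofReal (‖gradient φ ξ‖ ^ 2 / 4) := by
    rw [lintegral_eq_lintegral_polar _ hFm.ennreal_ofReal,
      lintegral_eq_lintegral_polar _ ((hgrad.measurable.norm.pow_const 2).div_const 4).ennreal_ofReal]
    exact setLIntegral_mono' measurableSet_Ioi fun r hr => hslice r hr
  have hfin : ∫⁻ ξ, ENNReal.ofReal (‖gradient φ ξ‖ ^ 2 / 4) < ∞ := hint4.lintegral_lt_top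
  -- Step C: integrability of `φ²/|ξ|²` and the inequality
  have hFint : Integrable (fun ξ : EuclideanSpace ℝ (Fin 2) => φ ξ ^ 2 / ‖ξ‖ ^ 2) :=
    ⟨hFm.aestronglyMeasurable, (hasFiniteIntegral_iff_ofReal (Filter.Eventually.of_forall fun ξ =>
      (by positivity : (0:ℝ) ≤ φ ξ ^ 2 / ‖ξ‖ ^ 2))).2 (lt_of_le_of_lt hle hfin)⟩
  refine ⟨hFint, ?_⟩
  rw [integral_eq_lintegral_of_nonneg_ae (Filter.Eventually.of_forall fun ξ =>
      (by positivity : (0:ℝ) ≤ φ ξ ^ 2 / ‖ξ‖ ^ 2)) hFm.aestronglyMeasurable]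
  have hR : ∫ ξ, ‖gradient φ ξ‖ ^ 2 / 4 =
      ENNReal.toReal (∫⁻ ξ, ENNReal.ofReal (‖gradient φ ξ‖ ^ 2 / 4)) :=
    integral_eq_lintegral_of_nonneg_ae (Filter.Eventually.of_forall fun ξ =>
      (by positivity : (0:ℝ) ≤ ‖gradient φ ξ‖ ^ 2 / 4)) hint4.aestronglyMeasurable
  have e : (1 / 4 : ℝ) * ∫ ξ, ‖gradient φ ξ‖ ^ 2 = ∫ ξ, ‖gradient φ ξ‖ ^ 2 / 4 := by
    rw [← MeasureTheory.integral_const_mul]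
    refine integral_congr_ae (Filter.Eventually.of_forall fun ξ => ?_)
    simp only
    ring
  rw [e, hR]
  exact ENNReal.toReal_mono hfin.ne hle

end Summit.AnomalousDissipation.AnomalousDissipation.Theorems.MarginalStabilityChainStretchedVortexRows

end
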